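import Summits.BirchSwinnertonDyer.Rank1Residual.Additive.KatoDescentDatum
import Literature.NumberTheory.EllipticCurves.Kato2004.IwasawaCohomologyLevelZero
import Literature.NumberTheory.EllipticCurves.KatoFineSelmerDual
import HarnessLib

set_option linter.dupNamespace false
set_option autoImplicit false

/-! # `IsKatoDescentDatumOf W p D` — the PIN of bsd-potss's abstract Kato descent datum `KatoDescentDatum p`
# to the tree's objects for `T = T_pW`: `D.H = 𝐇¹_Γ(T_pW)` (bsd-smallim's `Kato2004.IwasawaH1Data`),
# `D.A = H¹(ℤ[1/p], T_pW)` (`Kato2004.integralH1` at the bottom layer), `D.ι =` the first arrow of Kato's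
# (14.14.1) (`proj 0`), and `D.H2 ≈ X_st(E/ℚ_∞)` (the tree's fine-Selmer dual `FineSelmerDualData`) up to
# `p`-power torsion

Definition item `defn-IsKatoDescentDatumOf` (ledger; wanted by stmt-BirchSwinnertonDyer-19080 and -19160),
typed per the plan seat's decision `HOME/bsd-cn100-plan/DEFN-DECISIONS-g13.md` §Q1 (Summits-side, since
the predicate mentions the Summits-side structure `KatoDescentDatum`; a `Nonempty` of a structure of
identifications). Cell `bsd-cn100`, prover seat `bsd-cn100-s2-c3` (g7). HONEST FRAMING: a DEFINITION (a
structure of identifications and one `Prop`) plus unfolding lemmas; nothing is asserted, no named fact is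
minted, no instance/notation is declared; nothing about BSD, crux B of route `CongruentShaFreeCut` or the
congruent number problem is proved. PARTITION: none — RANK axis.

## What the consumer needs (and therefore what is pinned)

The KATO–ZETA road of crux B (`Theorems/CongruentShaFreeCutKatoZetaRoad.lean`, p448572; source:
Burungale–Skinner, App. A of arXiv:2210.10730, Thm. 10.1, §10.1.1–10.1.3) reads, over a datum
`D : KatoDescentDatum p` "of `(E, p)`": (R) such a datum exists; (K) Kato's main conjecture in `Λ ⊗ ℚ`,
`char_Λ(D.H2) · p^a = char_Λ(D.H ⧸ Λ·D.z) · p^b` [B–S Thm. 10.6 = Burungale–Tian 2026 Thm. 2.6: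
`ξ(H¹(ℤ[1/p],T⊗Λ)⊗ℚ / (Λ⊗ℚ)·𝐳_E) = ξ(X_st(E)⊗ℚ)`]; (3.1') `rank E(ℚ) = 1 ∧ #Ш[p^∞] < ∞ ⟹
D.H2/T·D.H2` finite [B–S §10.1.3: «Sel_st(E) is finite. The same is then true of
X_st(E)/(γ−1)X_st(E)»]; and (PR_p) Perrin-Riou's formula for the class `D.ι [D.z] ∈ D.A = H¹(ℤ[1/p],T)`
localised at `p`. Hence the pin must make `D.H`, `D.A`, `D.ι` THE tree objects, and `D.H2` the strict
Selmer dual UP TO what (K)/(3.1') can see — characteristic ideals up to powers of `p` and finiteness of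
the `Γ`-coinvariants, both invariant under maps whose kernel and cokernel are killed by a power of `p`.

* `D.H ≃ₗ[Λ] I.H` for a datum `I : Kato2004.IwasawaH1Data W p κ γ` of bsd-smallim (the pinned
  `𝐇¹_Γ(T_pW) = lim←_n H¹(ℤ_n[1/p], T_pW)` along the CYCLOTOMIC `ℤ_p`-extension `κ` with topological
  generator `γ`, `T = conj_γ − 1`; = Burungale–Skinner's `H¹(ℤ[1/p], T ⊗ Λ)` by Shapiro's lemma).
* `D.A ≃+ H¹(ℤ[1/p], T_pW) := Kato2004.integralH1 (tateRep W p) p (κ.layerSubgroup 0)` (Kato §8.2 /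
  Lemma 8.5: the classes of `H¹(ℚ, T_pW)` unramified away from `p`; `κ.layerSubgroup 0 = Γ_ℚ`),
  compatibly with the `ℤ_p`-module structures (`eA_C_smul`).
* `D.ι` = the first arrow of (14.14.1) `0 → 𝐇¹_Γ/T → H¹(ℤ[1/p],T) → (𝐇²)^Γ → 0`, i.e. bsd-smallim's
  `IwasawaH1Data.proj 0` (`projZero` on the coinvariants): `eA (D.ι [x]) = I.proj 0 (eH x)`.
* `D.H2` versus `X_st(E/ℚ_∞)`: Kato's `𝐇²(T)` (the `H2` slot of `KatoDescentDatum`, with the SECOND arrow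
  `D.π` of (14.14.1)) is not a tree object, and it is NOT isomorphic to the strict/fine Selmer dual:
  Poitou–Tate gives `0 → X_st → H²(ℤ[1/p], T⊗Λ) → lim← ⊕_{w∣p} E(ℚ_{n,w})[p^∞]^∨ → …` with a FINITE
  third term, and at `p = 2` the tree's fine Selmer group (`WeierstrassCurve.fineSelmerInfty`: locally
  trivial at EVERY place of `ℚ_∞`, the infinitely many real ones included) differs from B–S's `S_st` by
  `2`-torsion [B–S §10.1.1: «`X_st(E)` (in the guise of `H²(ℤ[1/p],T⊗_{ℤ_p}Λ)`) is a finitely-generated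
  torsion `Λ`-module»; over `ℚ_∞` "unramified at `w ∤ p`" = "trivial at `w ∤ p`" for `p`-primary
  coefficients, the residue field of `ℚ_{∞,w}` having pro-prime-to-`p` absolute Galois group]. So the pin
  is an ISOMORPHISM UP TO `p`-POWER TORSION: a submodule `Y ≤ D.H2` containing `p^k·D.H2` and a
  `Λ`-linear `q : Y → X.X` (`X : W.FineSelmerDualData κ γ`) whose kernel and cokernel are killed by `p^k`.
* `D.z` is NOT pinned beyond `D`'s own axioms (`z ≠ 0`, `D.H/Λz` torsion): with `D.H ≅ 𝐇¹_Γ` — free of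
  rank one over `Λ[1/p]` (Kato Thm. 12.4 (2)) — and `D.H2` pinned, the consumer's hypothesis (K) forces
  `D.z ∈ p^ℤ · Λˣ · 𝐳_E`, and every localisation/logarithm statement of the road is «`∃ c ≠ 0, …`»,
  insensitive to such a factor (a unit `u ∈ Λˣ` acts on `D.A` through `u(0) ∈ ℤ_pˣ`). The Euler-system
  pin of `𝐳_E` (bsd-smallim's `IwasawaH1Data.existsUnique_lift_of_zetaBody`) is available for odd `p`
  and `W[p]` irreducible only, neither of which holds for `(E_n, 2)`; it is not needed here.
* `D.π` is left free (it is determined up to the finite ambiguity above by `D`'s exactness axiom).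

REALISABILITY `∃ D, IsKatoDescentDatumOf W p D` is NOT asserted here: it is the reading (R) of the road
(Kato Thm. 12.4 (1)(2), (14.14.1)–(14.14.2); bsd-smallim's named facts `Kato2004.nonempty_iwasawaH1Data`,
`Kato2004.thm12_4` plus a `𝐇²`-package), to be filed as a Summits-side theorem over named facts or kept
as a displayed hypothesis.

References: K. Kato, Astérisque 295 (2004), §8.2 + Lemma 8.5 (pp. 180–184), Thm. 12.4 (p. 221), Thm. 12.5
(p. 222), Conj. 12.10 (p. 224), §14.14 (14.14.1)–(14.14.2) (p. 243) [Kato2004Asterisque]; A. Burungale,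
C. Skinner, App. A to Alpöge–Bhargava–Shnidman arXiv:2210.10730, §10.1.1 (p. 33), Thm. 10.6, §10.1.3
(p. 34) [AlpogeBhargavaShnidman2022]; A. Burungale, Y. Tian, Ann. of Math. 203 (2026) Thm. 2.6
[BurungaleTian2026]; tree: `Rank1Residual/Additive/KatoDescentDatum.lean` (bsd-potss),
`Kato2004/IwasawaCohomology.lean`, `Kato2004/IwasawaCohomologyLevelZero.lean` (bsd-smallim),
`KatoFineSelmerDual.lean`.
-/

noncomputable section

open scoped Classical

namespace Summit.BirchSwinnertonDyer.BirchSwinnertonDyer.Theorems.CongruentShaFreeCutKatoDescentDatumOf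

open WeierstrassCurve Field Literature.NumberTheory.EllipticCurves
  Literature.NumberTheory.EllipticCurves.Kato2004 Literature.NumberTheory.EllipticCurves.IwasawaAlgebra
  Literature.NumberTheory.EllipticCurves.Kato2004.EulerSystemValues
  Literature.NumberTheory.GaloisRepresentations
open Summit.BirchSwinnertonDyer.Rank1Residual.Additive (KatoDescentDatum)

/-! ## §1 The structure of identifications -/

/-- **The PIN of an abstract Kato descent datum `D : KatoDescentDatum p` to the tree's objects for
`T = T_pW`** (a structure of identifications; `IsKatoDescentDatumOf W p D := Nonempty (KatoDescentDatumPin W p D)`):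
a CYCLOTOMIC `ℤ_p`-extension datum `(κ, γ)`, bsd-smallim's Iwasawa cohomology `I : IwasawaH1Data W p κ γ`
(`I.H = 𝐇¹_Γ(T_pW) = H¹(ℤ[1/p], T_pW ⊗ Λ)`), a `Λ`-linear `eH : D.H ≃ I.H` [Kato Thm. 12.4 (2)], an
additive `eA : D.A ≃ H¹(ℤ[1/p], T_pW)` (`integralH1` at the bottom layer `κ.layerSubgroup 0 = Γ_ℚ`
[§8.2, Lemma 8.5]) compatible with the `ℤ_p`-structures (`eA_C_smul`) and carrying `D.ι` to the first
arrow `proj 0` of (14.14.1) (`eA_ι`), and for the `H2` slot a fine-Selmer dual datum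
`X : W.FineSelmerDualData κ γ` (`X.X = X_st(E/ℚ_∞)`, B–S §10.1.1) with an isomorphism UP TO `p`-POWER
TORSION `D.H2 ⊇ Y →ₗ X.X` (`p^k·D.H2 ⊆ Y`, `p^k` kills `ker q` and `X.X / range q`) — the exact shape in
which the road's readings (K) (characteristic ideals up to powers of `p`) and (3.1') (finiteness of the
coinvariants) see `𝐇²(T)` [B–S Thm. 10.6, §10.1.3]. `D.z` and `D.π` are not constrained beyond `D`'s own
axioms (module docstring). Nothing asserted. [cite: Kato2004Asterisque, Thm. 12.4 (p. 221), §8.2 and Lemma 8.5 (pp. 180–184), §14.14 (14.14.1) (p. 243)]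
[cite: AlpogeBhargavaShnidman2022, App. A §10.1.1 (p. 33) and Thm. 10.6] -/
structure KatoDescentDatumPin (W : WeierstrassCurve ℚ) [W.IsElliptic] (p : ℕ) [Fact p.Prime]
    [ContinuousSMul ℤ_[p] (W.tateModule p)] (D : KatoDescentDatum p) where
  /-- The cyclotomic `ℤ_p`-extension `ℚ_∞/ℚ`. -/
  κ : ZpExtension ℚ p
  /-- `κ` IS the cyclotomic `ℤ_p`-extension. -/
  isCyclotomic : κ.IsCyclotomic
  /-- A topological generator `γ` of `Γ = Gal(ℚ_∞/ℚ)` (through which `T ∈ Λ` acts as `γ − 1`). -/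
  γ : absoluteGaloisGroup ℚ
  /-- `γ` generates `Γ` topologically. -/
  isTopGenerator : κ.IsTopGenerator γ
  /-- bsd-smallim's pinned Iwasawa cohomology `𝐇¹_Γ(T_pW)` along `κ`. -/
  I : IwasawaH1Data W p κ γ
  /-- `D.H` IS `𝐇¹_Γ(T_pW)` (Kato Thm. 12.4 (2); B–S: `H¹(ℤ[1/p], T ⊗ Λ)`). -/
  eH : D.H ≃ₗ[IwasawaAlgebra p] I.H
  /-- `D.A` IS `H¹(ℤ[1/p], T_pW)` = the integral classes at the bottom layer (Kato §8.2, Lemma 8.5). -/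
  eA : D.A ≃+ ↥(integralH1 (tateRep W p) p (κ.layerSubgroup 0))
  /-- `eA` is `ℤ_p`-linear: the constants `C c ∈ Λ` act on `D.A` as `c` acts on `H¹(ℚ, T_pW)`. -/
  eA_C_smul : ∀ (c : ℤ_[p]) (a : D.A),
    ((eA (PowerSeries.C c • a) : ↥(integralH1 (tateRep W p) p (κ.layerSubgroup 0))) :
        H1 (tateRep W p) (κ.layerSubgroup 0)) =
      c • ((eA a : ↥(integralH1 (tateRep W p) p (κ.layerSubgroup 0))) :
        H1 (tateRep W p) (κ.layerSubgroup 0))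
  /-- `D.ι` IS the first arrow of Kato's (14.14.1): `eA (ι [x]) = proj₀ (eH x)` for every `x ∈ D.H`. -/
  eA_ι : ∀ x : D.H,
    ((eA (D.ι (Submodule.Quotient.mk x)) : ↥(integralH1 (tateRep W p) p (κ.layerSubgroup 0))) :
        H1 (tateRep W p) (κ.layerSubgroup 0)) =
      I.proj 0 (eH x)
  /-- The strict ( = fine over `ℚ_∞`) Selmer dual `X_st(E/ℚ_∞)` as a pinned `Λ`-module (tree datum). -/
  X : W.FineSelmerDualData κ γ
  /-- The exponent of the `p`-power ambiguity between `D.H2 = 𝐇²(T)` and `X_st`. -/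
  k : ℕ
  /-- The submodule of `D.H2` on which the comparison map is defined … -/
  Y : Submodule (IwasawaAlgebra p) D.H2
  /-- … which contains `p^k · D.H2`. -/
  pow_smul_mem : ∀ h : D.H2, ((p : IwasawaAlgebra p) ^ k) • h ∈ Y
  /-- The comparison map `Y → X_st(E/ℚ_∞)`. -/
  q : ↥Y →ₗ[IwasawaAlgebra p] X.X
  /-- `p^k` kills the kernel of `q`. -/
  pow_smul_eq_zero_of_q_eq_zero : ∀ y : ↥Y, q y = 0 → ((p : IwasawaAlgebra p) ^ k) • y = 0
  /-- `p^k` kills the cokernel of `q`. -/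
  pow_smul_mem_range : ∀ x : X.X, ((p : IwasawaAlgebra p) ^ k) • x ∈ LinearMap.range q

/-- **`IsKatoDescentDatumOf W p D`: «`D` IS Kato's §14.14 descent datum of `T_pW`» — the abstract
bsd-potss datum `D` admits a pin `KatoDescentDatumPin W p D` to the tree's `𝐇¹_Γ(T_pW)`, `H¹(ℤ[1/p],T_pW)`,
`proj 0` and (up to `p`-power torsion) `X_st(E/ℚ_∞)`.** The `ContinuousSMul ℤ_[p] (T_pW)` structure fact
used by `tateRep`/`IwasawaH1Data` is supplied by `TateModule.continuousSMul_padicInt`, so the signature is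
that of the road's interface slot `IsOf W p D`. A `Prop`; nothing asserted; realisability (reading (R))
is not claimed here. [cite: Kato2004Asterisque, Thm. 12.4 (p. 221) and §14.14 (14.14.1) (p. 243)]
[cite: AlpogeBhargavaShnidman2022, App. A §10.1.1 (p. 33)] -/
def IsKatoDescentDatumOf (W : WeierstrassCurve ℚ) [W.IsElliptic] (p : ℕ) [Fact p.Prime]
    (D : KatoDescentDatum p) : Prop :=
  letI : ContinuousSMul ℤ_[p] (W.tateModule p) := TateModule.continuousSMul_padicInt
  Nonempty (KatoDescentDatumPin W p D)

/-! ## §2 Unfolding lemmas -/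

section Unfolding

variable {W : WeierstrassCurve ℚ} [W.IsElliptic] {p : ℕ} [Fact p.Prime] {D : KatoDescentDatum p}

/-- Unfolding: `IsKatoDescentDatumOf W p D` is the inhabitedness of `KatoDescentDatumPin W p D` (with the
canonical `ContinuousSMul ℤ_[p] (T_pW)`). [cite: Kato2004Asterisque, §14.14 (14.14.1) (p. 243)] -/
theorem isKatoDescentDatumOf_iff :
    IsKatoDescentDatumOf W p D ↔
      Nonempty (@KatoDescentDatumPin W _ p _ TateModule.continuousSMul_padicInt D) :=
  Iff.rfl

/-- A pin yields `IsKatoDescentDatumOf` (for any instance of the `Prop`-valued structure fact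
`ContinuousSMul ℤ_[p] (T_pW)`, by proof irrelevance). [cite: Kato2004Asterisque, §14.14 (14.14.1) (p. 243)] -/
theorem isKatoDescentDatumOf_of_pin [inst : ContinuousSMul ℤ_[p] (W.tateModule p)]
    (P : KatoDescentDatumPin W p D) : IsKatoDescentDatumOf W p D := by
  have h : inst = TateModule.continuousSMul_padicInt := Subsingleton.elim _ _
  subst h
  exact ⟨P⟩

end Unfolding

namespace KatoDescentDatumPin

variable {W : WeierstrassCurve ℚ} [W.IsElliptic] {p : ℕ} [Fact p.Prime]
  [ContinuousSMul ℤ_[p] (W.tateModule p)] {D : KatoDescentDatum p} (P : KatoDescentDatumPin W p D)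

/-- The class `eA (ι [x])` is an INTEGRAL class (`H¹(ℤ[1/p], T_pW)`): immediate from the type of `eA`
(equivalently from `IwasawaH1Data.proj_mem`). [cite: Kato2004Asterisque, §8.2 and §14.14 (pp. 180, 243)] -/
theorem eA_ι_mem (x : D.H) :
    P.I.proj 0 (P.eH x) ∈ integralH1 (tateRep W p) p (P.κ.layerSubgroup 0) := by
  rw [← P.eA_ι x]
  exact (P.eA (D.ι (Submodule.Quotient.mk x))).2

/-- `eA` transports the action of `p^m ∈ Λ` on `D.A` to multiplication by `p^m` on `H¹(ℚ, T_pW)`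
(`(p : Λ)^m = C (p^m)` and `eA_C_smul`) — the currency in which the road states «`ι [z]` is not
`ℤ_p`-torsion» (`∀ m, p^m • D.ι [D.z] ≠ 0`). [cite: Kato2004Asterisque, §14.14 (14.14.1) (p. 243)] -/
theorem eA_natCast_pow_smul (m : ℕ) (a : D.A) :
    ((P.eA (((p : IwasawaAlgebra p) ^ m) • a) : ↥(integralH1 (tateRep W p) p (P.κ.layerSubgroup 0))) :
        H1 (tateRep W p) (P.κ.layerSubgroup 0)) =
      ((p : ℤ_[p]) ^ m) • ((P.eA a : ↥(integralH1 (tateRep W p) p (P.κ.layerSubgroup 0))) :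
        H1 (tateRep W p) (P.κ.layerSubgroup 0)) := by
  have hC : ((p : IwasawaAlgebra p) ^ m) = PowerSeries.C ((p : ℤ_[p]) ^ m) := by
    rw [map_pow, map_natCast]
  rw [hC, P.eA_C_smul]

/-- `eA` detects `ℤ_p`-torsion: `p^m • ι [x] = 0` in `D.A` iff `p^m • proj₀ (eH x) = 0` in `H¹(ℚ, T_pW)`.
[cite: Kato2004Asterisque, §14.14 (14.14.1) (p. 243)] -/
theorem pow_smul_ι_eq_zero_iff (m : ℕ) (x : D.H) :
    ((p : IwasawaAlgebra p) ^ m) • D.ι (Submodule.Quotient.mk x) = 0 ↔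
      ((p : ℤ_[p]) ^ m) • P.I.proj 0 (P.eH x) = 0 := by
  have key : ((P.eA (((p : IwasawaAlgebra p) ^ m) • D.ι (Submodule.Quotient.mk x)) :
      ↥(integralH1 (tateRep W p) p (P.κ.layerSubgroup 0))) : H1 (tateRep W p) (P.κ.layerSubgroup 0)) =
      ((p : ℤ_[p]) ^ m) • P.I.proj 0 (P.eH x) := by
    rw [P.eA_natCast_pow_smul, P.eA_ι]
  constructor
  · intro h
    rw [h, map_zero] at key
    exact key.symm.trans rfl
  · intro h
    rw [h] at key
    have h0 : P.eA (((p : IwasawaAlgebra p) ^ m) • D.ι (Submodule.Quotient.mk x)) = 0 :=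
      Subtype.ext key
    exact (map_eq_zero_iff P.eA P.eA.injective).mp h0

/-- The comparison map `q` becomes an isomorphism after inverting `p`: restated as «`p^k` kills kernel and
cokernel, and `p^k · D.H2 ⊆ Y`» (bundled). [cite: AlpogeBhargavaShnidman2022, App. A §10.1.1 (p. 33)] -/
theorem isIsoUpToPPow :
    (∀ h : D.H2, ((p : IwasawaAlgebra p) ^ P.k) • h ∈ P.Y) ∧
    (∀ y : ↥P.Y, P.q y = 0 → ((p : IwasawaAlgebra p) ^ P.k) • y = 0) ∧
    (∀ x : P.X.X, ((p : IwasawaAlgebra p) ^ P.k) • x ∈ LinearMap.range P.q) :=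
  ⟨P.pow_smul_mem, P.pow_smul_eq_zero_of_q_eq_zero, P.pow_smul_mem_range⟩

end KatoDescentDatumPin

end Summit.BirchSwinnertonDyer.BirchSwinnertonDyer.Theorems.CongruentShaFreeCutKatoDescentDatumOf

end
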